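import Summits.ResolutionOfSingularities.ResolutionOfSingularities.Theorems.FrobeniusClosingSteerCriticalSurfaceDictionary
import HarnessLib

/-!
# Crux `Steer` (stmt-ResolutionOfSingularities-16345), chain W4.1, p = 2 σ-residual, LOW half: the CRITICAL-SURFACE DICTIONARY
# (C7) along ANY SURJECTION `π : R → S` with kernel the critical ideal `(D₁ f, D₂ f)` and a UNIT Hessian determinant
# (Theses-free, def-free; sibling of res-L0-w41-lead-1's quotient edition `CriticalSurface.singAlongCriticalSurface`, p513150)

OURS (campaign `res-hironaka`, rung L ★L-G4, slot W4.1; res-D-pv-012 AS res-L0-w41-stub-8 SHAPE ASK HOME/STATUS 2026-08-27T10:23:07Z for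
§σ2.24 D3a `LowTowerExistsTwo`, clauses (T3)/(T9); taken by res-type-072 g14 10:35:28Z; replaces the role of no printed item; NOT a
statement of the manuscript under review [claim: Hironaka2017, status: under-review]; AI review is weaker than expert review).

* **`CriticalSurface.singAlong_of_surjective`** — let `R`, `S` be regular local rings of characteristic `2`, `π : R → S` a SURJECTIVE ring
  map with `ker π = (D₁ f, D₂ f)` for a radicand `f ∈ R` and derivations `D₁, D₂` of `R` whose Hessian determinant
  `D₁D₁f·D₂D₂f − D₁D₂f·D₂D₁f` is a UNIT (res-L0-w41-stub-3's `Inv`-binders: Jacobian pair + unit Hessian; no low-shape coordinates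
  `l₁ … l₄, c`). Then for every prime `Q'` of `S`: the torsor `T² = f` is singular at `Q = Q'.comap π` IFF `T² = π f` is singular at `Q'`
  (res-type-082's atPrime form on both sides). (⇒) reduction along the local homomorphism `R_Q → S_{Q'}`; (⇐) lift through `π` and clear
  denominators, `U² f − γ₀² = q + A·D₁ f + B·D₂ f` with `q ∈ Q²`, apply `D₁, D₂` (which kill squares and map `Q²` into `Q`): the rows
  `M·(A, B)ᵀ` lie in `Q` with `det M` a unit, so `A, B ∈ Q` and `U² f − γ₀² ∈ Q²`. The proof is res-L0-w41-lead-1's C7 VERBATIM with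
  `Ideal.Quotient.mk P₀` replaced by `π` (`mk_surjective ↦ hπ`, `Quotient.eq ↦ hker`; the inputs `criticalSurface` / `isUnit_det_jacobianPair`
  become the hypotheses `[IsRegularLocalRing S]` / `hdet`) — adapted from `FrobeniusClosingSteerCriticalSurfaceDictionary.lean`.

Consumer: res-D-pv-012's D3a assembly `exists_lowTower` — the surface germ there is the IMAGE SUBRING `A n = ψ(R n) ⊆ L` (`ψ` surjective,
`ker ψ = 𝔮_n = (δ₁ f, δ₂ f)` by stub-3's `Inv`), not the quotient type: (T9) = (⇐) at a curve prime of `A n` with regular quotient, (T3) = (⇐)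
at `Q' = ⊥`. [cite: Matsumura1987, Thm. 14.2] [folklore]
-/

noncomputable section

-- `Summit.<S>.<S>.…` duplicates the summit name by design (single-problem summit).
set_option linter.dupNamespace false

open Polynomial IsLocalRing

namespace Summit.ResolutionOfSingularities.ResolutionOfSingularities.Theorems.SwitchingDichotomy

open Literature.AlgebraicGeometry.Resolution

namespace CriticalSurface

universe u

/-! ## (C7, surjection edition) Singular loci correspond along `π : R ↠ S`, `ker π = (D₁ f, D₂ f)`, unit Hessian -/

section DictionarySurj

variable {R S : Type u} [CommRing R] [IsRegularLocalRing R] [CharP R 2] [CommRing S] [IsRegularLocalRing S] [CharP S 2]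

/-- **(C7 along a surjection) Singular loci correspond along the critical surface, image-subring form** (res-D-pv-012's SHAPE ASK
2026-08-27T10:23:07Z, signature verbatim): `R`, `S` regular local of characteristic `2`, `π : R → S` surjective with
`π r = 0 ↔ r ∈ (D₁ f, D₂ f)`, the Hessian determinant `D₁D₁f·D₂D₂f − D₁D₂f·D₂D₁f` a unit; then for every prime `Q'` of `S` the torsor
`T² = f` is SINGULAR at `Q'.comap π` IFF `T² = π f` is singular at `Q'` (both in res-type-082's `AdjoinRoot … atPrime` form).
(⇒) reduce `f − γ² ∈ 𝔪_Q²` along `R_Q → S_{Q'}`; (⇐) lift, clear denominators, `U² f − γ₀² = q + A·D₁ f + B·D₂ f` (`q ∈ Q²`), apply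
`D₁, D₂` and Cramer with the unit determinant: `A, B ∈ Q`, so `U² f − γ₀² ∈ Q²`. Adapted from res-L0-w41-lead-1's
`singAlongCriticalSurface` (p513150: `π = Ideal.Quotient.mk P₀`, low-shape binders). OURS. [cite: Matsumura1987, Thm. 14.2] [folklore] -/
theorem singAlong_of_surjective (π : R →+* S) (hπ : Function.Surjective π) (f : R) (D₁ D₂ : Derivation ℤ R R)
    (hker : ∀ r : R, π r = 0 ↔ r ∈ Ideal.span {D₁ f, D₂ f})
    (hdet : IsUnit (D₁ (D₁ f) * D₂ (D₂ f) - D₁ (D₂ f) * D₂ (D₁ f))) (Q' : Ideal S) [Q'.IsPrime] :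
    ¬ IsRegularLocalRing (AdjoinRoot ((X : (Localization.AtPrime (Q'.comap π))[X]) ^ 2 -
      C (algebraMap R (Localization.AtPrime (Q'.comap π)) f))) ↔
    ¬ IsRegularLocalRing (AdjoinRoot ((X : (Localization.AtPrime Q')[X]) ^ 2 -
      C (algebraMap S (Localization.AtPrime Q') (π f)))) := by
  -- adapted from FrobeniusClosingSteerCriticalSurfaceDictionary.lean (res-L0-w41-lead-1, C7), `Ideal.Quotient.mk P₀ ↦ π`
  classical
  haveI : Fact (2 : ℕ).Prime := ⟨Nat.prime_two⟩
  set Q : Ideal R := Q'.comap π with hQ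
  haveI hQprime : Q.IsPrime := Ideal.comap_isPrime π Q'
  set L := Localization.AtPrime Q with hL
  set L' := Localization.AtPrime Q' with hL'
  haveI : IsRegularLocalRing L := isRegularLocalRing_localization_atPrime R Q
  haveI : IsRegularLocalRing L' := isRegularLocalRing_localization_atPrime S Q'
  haveI : CharP L 2 := AutoPermissible.charP_localization_atPrime (S := R) 2 Q
  haveI : CharP L' 2 := AutoPermissible.charP_localization_atPrime (S := S) 2 Q'
  have hkerQ : ∀ r : R, π r = 0 → r ∈ Q := by
    intro r hr
    rw [hQ, Ideal.mem_comap, hr]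
    exact Q'.zero_mem
  have he₁Q : D₁ f ∈ Q := hkerQ _ ((hker _).mpr (Ideal.subset_span (by simp)))
  have he₂Q : D₂ f ∈ Q := hkerQ _ ((hker _).mpr (Ideal.subset_span (by simp)))
  rw [RadicandSingular.not_isRegularLocalRing_adjoinRoot_atPrime_iff 2 Q f,
    RadicandSingular.not_isRegularLocalRing_adjoinRoot_atPrime_iff 2 Q' (π f)]
  constructor
  · -- (⇒) reduce along the local homomorphism `R_Q → S_{Q'}`
    rintro ⟨γ, hγ⟩
    let φ : L →+* L' := Localization.localRingHom Q Q' π rfl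
    have hmap : Ideal.map φ (maximalIdeal L) ≤ maximalIdeal L' := by
      refine Ideal.map_le_iff_le_comap.mpr fun x hx => ?_
      rw [Ideal.mem_comap]
      rw [IsLocalRing.mem_maximalIdeal, mem_nonunits_iff] at hx ⊢
      exact fun hu => hx ((isUnit_map_iff φ x).mp hu)
    refine ⟨φ γ, ?_⟩
    have h1 : φ (algebraMap R L f - γ ^ 2) = algebraMap S L' (π f) - φ γ ^ 2 := by
      rw [map_sub, map_pow, Localization.localRingHom_to_map]
    rw [← h1]
    have h2 : φ (algebraMap R L f - γ ^ 2) ∈ Ideal.map φ (maximalIdeal L ^ 2) := Ideal.mem_map_of_mem _ hγ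
    rw [Ideal.map_pow] at h2
    exact Ideal.pow_right_mono hmap 2 h2
  · -- (⇐) lift through `π`, clear denominators, apply the derivations
    rintro ⟨γ', hγ'⟩
    obtain ⟨⟨abar, sbar⟩, rfl⟩ := IsLocalization.mk'_surjective Q'.primeCompl γ'
    obtain ⟨a, rfl⟩ := hπ abar
    obtain ⟨s, hs⟩ := hπ (sbar : S)
    have hsQ : s ∉ Q := by
      intro h
      have h' : π s ∈ Q' := h
      rw [hs] at h'
      exact sbar.2 h'
    -- `s̄² (π f) − ā²` maps into `𝔪_{L'}²`
    have h1 : algebraMap S L' (π (s ^ 2 * f - a ^ 2)) ∈ maximalIdeal L' ^ 2 := by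
      have hs' : algebraMap S L' (π (s ^ 2 * f - a ^ 2)) =
          algebraMap S L' ((sbar : S) ^ 2) *
            (algebraMap S L' (π f) - IsLocalization.mk' L' (π a) sbar ^ 2) := by
        rw [map_sub π, map_mul π, map_pow π, map_pow π, hs, map_sub, map_mul, mul_sub, map_pow, map_pow,
          ← mul_pow, IsLocalization.mk'_spec' L' (π a) sbar]
      rw [hs']
      exact Ideal.mul_mem_left _ _ hγ'
    rw [← Localization.AtPrime.map_eq_maximalIdeal, ← Ideal.map_pow,
      IsLocalization.algebraMap_mem_map_algebraMap_iff Q'.primeCompl] at h1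
    obtain ⟨ubar, hubar, h2⟩ := h1
    obtain ⟨u, rfl⟩ := hπ ubar
    have huQ : u ∉ Q := fun h => hubar (by rw [hQ, Ideal.mem_comap] at h; exact h)
    -- pull back to `R`: `u (s² f − a²) ∈ Q² + ker π`
    have hQ'map : Q' = Ideal.map π Q := by
      rw [hQ, Ideal.map_comap_of_surjective _ hπ]
    have h3 : π (u * (s ^ 2 * f - a ^ 2)) ∈ Ideal.map π (Q ^ 2) := by
      rw [Ideal.map_pow, ← hQ'map, map_mul]
      exact h2
    obtain ⟨q, hq, hq'⟩ := (Ideal.mem_map_iff_of_surjective π hπ).mp h3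
    have h4 : u * (s ^ 2 * f - a ^ 2) - q ∈ Ideal.span {D₁ f, D₂ f} := by
      refine (hker _).mp ?_
      rw [map_sub, ← hq', sub_self]
    obtain ⟨a₀, b₀, hab⟩ := Ideal.mem_span_pair.mp h4
    -- multiply by `u`: `U² f − γ₀² = q₁ + A e₁ + B e₂`
    have hUQ : u * s ∉ Q := fun h => (Ideal.IsPrime.mem_or_mem inferInstance h).elim huQ hsQ
    have hq₁Q : u * q ∈ Q ^ 2 := Ideal.mul_mem_left _ _ hq
    have key : (u * s) ^ 2 * f - (u * a) ^ 2 = u * q + (u * a₀) * D₁ f + (u * b₀) * D₂ f := by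
      have h : u * (u * (s ^ 2 * f - a ^ 2) - q) = u * (a₀ * D₁ f + b₀ * D₂ f) := by rw [hab]
      linear_combination h
    -- apply `D₁`, `D₂`: the rows `A·D(D₁ f) + B·D(D₂ f) ∈ Q`
    have hrow : ∀ D : Derivation ℤ R R, D f ∈ Q →
        (u * a₀) * D (D₁ f) + (u * b₀) * D (D₂ f) ∈ Q := by
      intro D hDf
      have hl : D ((u * s) ^ 2 * f - (u * a) ^ 2) = (u * s) ^ 2 * D f := by
        rw [map_sub, D.leibniz, derivation_apply_sq, derivation_apply_sq]; simp [smul_eq_mul]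
      have hr : D (u * q + (u * a₀) * D₁ f + (u * b₀) * D₂ f) =
          D (u * q) + D₁ f * D (u * a₀) + D₂ f * D (u * b₀) +
            ((u * a₀) * D (D₁ f) + (u * b₀) * D (D₂ f)) := by
        rw [map_add, map_add, D.leibniz (u * a₀), D.leibniz (u * b₀)]
        simp only [smul_eq_mul]
        ring
      have h5 : (u * a₀) * D (D₁ f) + (u * b₀) * D (D₂ f) =
          (u * s) ^ 2 * D f - D (u * q) - D₁ f * D (u * a₀) - D₂ f * D (u * b₀) := by
        have h := congrArg D key
        rw [hl, hr] at h
        linear_combination -h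
      rw [h5]
      refine Ideal.sub_mem _ (Ideal.sub_mem _ (Ideal.sub_mem _ (Ideal.mul_mem_left _ _ hDf)
        (derivation_apply_mem_of_mem_sq D Q hq₁Q)) (Ideal.mul_mem_right _ _ he₁Q)) (Ideal.mul_mem_right _ _ he₂Q)
    have r1 := hrow D₁ he₁Q
    have r2 := hrow D₂ he₂Q
    -- Cramer with the unit determinant
    set d : R := D₁ (D₁ f) * D₂ (D₂ f) - D₁ (D₂ f) * D₂ (D₁ f) with hd
    have hdQ : d ∉ Q := fun h => (Ideal.IsPrime.ne_top inferInstance)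
      (Ideal.eq_top_of_isUnit_mem _ h hdet)
    have hA : u * a₀ ∈ Q := by
      have h : d * (u * a₀) = D₂ (D₂ f) * ((u * a₀) * D₁ (D₁ f) + (u * b₀) * D₁ (D₂ f)) -
          D₁ (D₂ f) * ((u * a₀) * D₂ (D₁ f) + (u * b₀) * D₂ (D₂ f)) := by rw [hd]; ring
      have hmem : d * (u * a₀) ∈ Q := by
        rw [h]; exact Ideal.sub_mem _ (Ideal.mul_mem_left _ _ r1) (Ideal.mul_mem_left _ _ r2)
      exact (Ideal.IsPrime.mem_or_mem inferInstance hmem).resolve_left hdQ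
    have hB : u * b₀ ∈ Q := by
      have h : d * (u * b₀) = D₁ (D₁ f) * ((u * a₀) * D₂ (D₁ f) + (u * b₀) * D₂ (D₂ f)) -
          D₂ (D₁ f) * ((u * a₀) * D₁ (D₁ f) + (u * b₀) * D₁ (D₂ f)) := by rw [hd]; ring
      have hmem : d * (u * b₀) ∈ Q := by
        rw [h]; exact Ideal.sub_mem _ (Ideal.mul_mem_left _ _ r2) (Ideal.mul_mem_left _ _ r1)
      exact (Ideal.IsPrime.mem_or_mem inferInstance hmem).resolve_left hdQ
    -- hence `U² f − γ₀² ∈ Q²`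
    have hsq : (u * s) ^ 2 * f - (u * a) ^ 2 ∈ Q ^ 2 := by
      rw [key, pow_two]
      refine Ideal.add_mem _ (Ideal.add_mem _ (by rw [← pow_two]; exact hq₁Q) (Ideal.mul_mem_mul hA he₁Q))
        (Ideal.mul_mem_mul hB he₂Q)
    -- and `f − (γ₀/U)² ∈ 𝔪_L²`
    have hUs : u * s ∈ Q.primeCompl := hUQ
    refine ⟨IsLocalization.mk' L (u * a) ⟨u * s, hUs⟩, ?_⟩
    have hunit : IsUnit (algebraMap R L ((u * s) ^ 2)) := by
      rw [map_pow]; exact (IsLocalization.map_units L ⟨u * s, hUs⟩).pow 2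
    rw [← Ideal.unit_mul_mem_iff_mem _ hunit]
    have heq : algebraMap R L ((u * s) ^ 2) * (algebraMap R L f - IsLocalization.mk' L (u * a) ⟨u * s, hUs⟩ ^ 2) =
        algebraMap R L ((u * s) ^ 2 * f - (u * a) ^ 2) := by
      rw [map_sub, map_mul, mul_sub, map_pow, map_pow (algebraMap R L) (u * a), ← mul_pow]
      congr 2
      exact IsLocalization.mk'_spec' L (u * a) ⟨u * s, hUs⟩
    rw [heq, ← Localization.AtPrime.map_eq_maximalIdeal, ← Ideal.map_pow]
    exact Ideal.mem_map_of_mem _ hsq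

end DictionarySurj

end CriticalSurface

end Summit.ResolutionOfSingularities.ResolutionOfSingularities.Theorems.SwitchingDichotomy

end
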